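import Mathlib
import HarnessLib
import Literature.Analysis.FluidPDE.TaoCascadeODEProofs
import Literature.Analysis.FluidPDE.Tao2016AveragedNS.LocalCascadeSolutions
import Summits.NavierStokesRegularity.NavierStokesRegularity.Theses.CompletionRelayChain
import Summits.NavierStokesRegularity.NavierStokesRegularity.Theorems.HeteroclinicTriggerChainTriggerChainTableStatic

/-!
# `CompletionRelayChain` — crux `RelayTable` (item stmt-NavierStokesRegularity-24851): CLOSED

The existential DESIGN crux of route `CompletionRelayChain` (rung TL-M3-R64, a MODEL lattice in
Tao's table class E₂(R); Tao 2016, *Finite time blowup for an averaged three-dimensional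
Navier–Stokes equation*, §4–§6): there is a four-mode table `α` on Tao's topology
`S = {(0,0,0),(1,0,0),(0,1,0),(0,0,1)}` which is symmetric (4.2), cancelling (4.3) and
`64`-comparable (all entries of modulus `≤ 1`, non-zero ones `≥ 1/64`), and whose cascade
nonlinearity `quadTerm 1 α` has EXACTLY the completion-relay rows (carrier `x` = mode `0`,
trigger `u` = mode `1`, relay `r` = mode `2`, mode `3` idle, `Λ_n = 2^{5n/2}`):

* `ẋ_n`-term `-Λ_n u_n² + Λ_{n-1} u_{n-1}²`,
* `u̇_n`-term `Λ_n (x_n u_n - u_n x_{n+1}) - (1/32) Λ_n x_{n+1} r_n + (1/32) Λ_{n-1} r_{n-1} u_{n-1}`,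
* `ṙ_n`-term `(1/32) Λ_n (x_{n+1} u_n - u_n u_{n+1})`,
* mode `3`: `0`.

THE WITNESS (planner ns-idea-4's design, machine-checked in the item's evidence file
`RelayTable_check.lean`, sha 7585829e956442c1, ported here against the LIVE route module): the skew
form `α = τ - (13)τ + (12)τ - (12)(13)τ`, i.e.
`α(a,b,c,(μ₁,μ₂,μ₃)) = τ(a,b,c,μ) - τ(c,b,a,(μ₃,μ₂,μ₁)) + τ(b,a,c,(μ₂,μ₁,μ₃)) - τ(c,a,b,(μ₃,μ₁,μ₂))`,
of the single-row generator with the four non-zero entries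
`τ(0,1,1,(0,0,0)) = 1/2`, `τ(0,1,1,(1,0,0)) = -1/2` (trigger / transfer — the `e = g = 1` table `α₀`
of route `HeteroclinicTriggerChain`), `τ(1,0,2,(0,1,0)) = 1/64` (relay charge `r_n ← x_{n+1} u_n` and
arming `u_n ← -x_{n+1} r_n`), `τ(2,1,1,(0,0,1)) = 1/64` (fire `u_{n+1} ← r_n u_n` and relay drain
`r_n ← -u_n u_{n+1}`). Symmetry and cancellation hold for ANY skew-form table
(`TriggerChainTable.heteroclinicTriggerChain_isSymmetricCoeff_of_skew` /
`…_isCancellingCoeff_of_skew`, tree); the value set of `α` on `S` is `{0, ±1/2, ±1, ±1/64}` (finite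
case analysis, one lemma per shift vector), whence `64`-comparability; the rows are the closed
forms of the finite sum `quadTerm 1 α` (`simp` + `ring`).

The file is definition-free: the generator and the table enter the lemmas as hypotheses
`hτ : τ = …`, `hα : α = …` and are instantiated by `rfl` in the closing theorem.

HONEST FRAMING: this closes the provable-now DESIGN crux of a line on a MODEL rung (D-0061); the
line's deciding crux `RelayFrontStep` (the robust front step, XL) is untouched, and nothing here is
a statement about the Navier–Stokes equations — NS regularity is neither proved nor refuted by this
file, and no rung is closed by it alone.
-/

noncomputable section

-- the summit-side namespace `Summit.NavierStokesRegularity.NavierStokesRegularity.…` (single-conjunct summit,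
-- D-0017) repeats a component by design; the dupNamespace linter would flag every declaration.
set_option linter.dupNamespace false

open Literature.Analysis.FluidPDE.TaoCascade

namespace Summit.NavierStokesRegularity.NavierStokesRegularity.Theorems

namespace RelayTable

/-- Value set of the relay table at the same-shell shift `μ = (0,0,0)`: only `0, ±1/2, -1` occur
(the trigger rows `α(0,1,1) = α(1,0,1) = 1/2`, `α(1,1,0) = -1`); stated inside the seven-value
disjunction used for comparability. [this file] -/
theorem values_zero (τ α : Fin 4 → Fin 4 → Fin 4 → ℤ × ℤ × ℤ → ℝ)
    (hτ : τ = fun (a b c : Fin 4) (μ : ℤ × ℤ × ℤ) =>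
      if a = 0 ∧ b = 1 ∧ c = 1 then
        (if μ = (0, 0, 0) then (1 : ℝ) / 2 else if μ = (1, 0, 0) then -(1 / 2) else 0)
      else if a = 1 ∧ b = 0 ∧ c = 2 then (if μ = (0, 1, 0) then (1 : ℝ) / 64 else 0)
      else if a = 2 ∧ b = 1 ∧ c = 1 then (if μ = (0, 0, 1) then (1 : ℝ) / 64 else 0)
      else 0)
    (hα : α = fun (a b c : Fin 4) (μ : ℤ × ℤ × ℤ) => τ a b c μ - τ c b a (μ.2.2, μ.2.1, μ.1) +
      τ b a c (μ.2.1, μ.1, μ.2.2) - τ c a b (μ.2.2, μ.1, μ.2.1)) (a b c : Fin 4) :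
    α a b c (0, 0, 0) = 0 ∨ α a b c (0, 0, 0) = 1 / 2 ∨ α a b c (0, 0, 0) = -(1 / 2) ∨
      α a b c (0, 0, 0) = 1 ∨ α a b c (0, 0, 0) = -1 ∨ α a b c (0, 0, 0) = 1 / 64 ∨
      α a b c (0, 0, 0) = -(1 / 64) := by
  subst hα hτ
  fin_cases a <;> fin_cases b <;> fin_cases c <;> norm_num [Fin.ext_iff]

/-- Value set of the relay table at the shift `μ = (1,0,0)`: only `0, ±1/2, ±1/64, 1` occur.
[this file] -/
theorem values_one (τ α : Fin 4 → Fin 4 → Fin 4 → ℤ × ℤ × ℤ → ℝ)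
    (hτ : τ = fun (a b c : Fin 4) (μ : ℤ × ℤ × ℤ) =>
      if a = 0 ∧ b = 1 ∧ c = 1 then
        (if μ = (0, 0, 0) then (1 : ℝ) / 2 else if μ = (1, 0, 0) then -(1 / 2) else 0)
      else if a = 1 ∧ b = 0 ∧ c = 2 then (if μ = (0, 1, 0) then (1 : ℝ) / 64 else 0)
      else if a = 2 ∧ b = 1 ∧ c = 1 then (if μ = (0, 0, 1) then (1 : ℝ) / 64 else 0)
      else 0)
    (hα : α = fun (a b c : Fin 4) (μ : ℤ × ℤ × ℤ) => τ a b c μ - τ c b a (μ.2.2, μ.2.1, μ.1) +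
      τ b a c (μ.2.1, μ.1, μ.2.2) - τ c a b (μ.2.2, μ.1, μ.2.1)) (a b c : Fin 4) :
    α a b c (1, 0, 0) = 0 ∨ α a b c (1, 0, 0) = 1 / 2 ∨ α a b c (1, 0, 0) = -(1 / 2) ∨
      α a b c (1, 0, 0) = 1 ∨ α a b c (1, 0, 0) = -1 ∨ α a b c (1, 0, 0) = 1 / 64 ∨
      α a b c (1, 0, 0) = -(1 / 64) := by
  subst hα hτ
  fin_cases a <;> fin_cases b <;> fin_cases c <;> norm_num [Fin.ext_iff]

/-- Value set of the relay table at the shift `μ = (0,1,0)`: only `0, ±1/2, ±1/64` occur.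
[this file] -/
theorem values_two (τ α : Fin 4 → Fin 4 → Fin 4 → ℤ × ℤ × ℤ → ℝ)
    (hτ : τ = fun (a b c : Fin 4) (μ : ℤ × ℤ × ℤ) =>
      if a = 0 ∧ b = 1 ∧ c = 1 then
        (if μ = (0, 0, 0) then (1 : ℝ) / 2 else if μ = (1, 0, 0) then -(1 / 2) else 0)
      else if a = 1 ∧ b = 0 ∧ c = 2 then (if μ = (0, 1, 0) then (1 : ℝ) / 64 else 0)
      else if a = 2 ∧ b = 1 ∧ c = 1 then (if μ = (0, 0, 1) then (1 : ℝ) / 64 else 0)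
      else 0)
    (hα : α = fun (a b c : Fin 4) (μ : ℤ × ℤ × ℤ) => τ a b c μ - τ c b a (μ.2.2, μ.2.1, μ.1) +
      τ b a c (μ.2.1, μ.1, μ.2.2) - τ c a b (μ.2.2, μ.1, μ.2.1)) (a b c : Fin 4) :
    α a b c (0, 1, 0) = 0 ∨ α a b c (0, 1, 0) = 1 / 2 ∨ α a b c (0, 1, 0) = -(1 / 2) ∨
      α a b c (0, 1, 0) = 1 ∨ α a b c (0, 1, 0) = -1 ∨ α a b c (0, 1, 0) = 1 / 64 ∨
      α a b c (0, 1, 0) = -(1 / 64) := by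
  subst hα hτ
  fin_cases a <;> fin_cases b <;> fin_cases c <;> norm_num [Fin.ext_iff]

/-- Value set of the relay table at the shift `μ = (0,0,1)`: only `0, ±1/64, 1` occur.
[this file] -/
theorem values_three (τ α : Fin 4 → Fin 4 → Fin 4 → ℤ × ℤ × ℤ → ℝ)
    (hτ : τ = fun (a b c : Fin 4) (μ : ℤ × ℤ × ℤ) =>
      if a = 0 ∧ b = 1 ∧ c = 1 then
        (if μ = (0, 0, 0) then (1 : ℝ) / 2 else if μ = (1, 0, 0) then -(1 / 2) else 0)
      else if a = 1 ∧ b = 0 ∧ c = 2 then (if μ = (0, 1, 0) then (1 : ℝ) / 64 else 0)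
      else if a = 2 ∧ b = 1 ∧ c = 1 then (if μ = (0, 0, 1) then (1 : ℝ) / 64 else 0)
      else 0)
    (hα : α = fun (a b c : Fin 4) (μ : ℤ × ℤ × ℤ) => τ a b c μ - τ c b a (μ.2.2, μ.2.1, μ.1) +
      τ b a c (μ.2.1, μ.1, μ.2.2) - τ c a b (μ.2.2, μ.1, μ.2.1)) (a b c : Fin 4) :
    α a b c (0, 0, 1) = 0 ∨ α a b c (0, 0, 1) = 1 / 2 ∨ α a b c (0, 0, 1) = -(1 / 2) ∨
      α a b c (0, 0, 1) = 1 ∨ α a b c (0, 0, 1) = -1 ∨ α a b c (0, 0, 1) = 1 / 64 ∨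
      α a b c (0, 0, 1) = -(1 / 64) := by
  subst hα hτ
  fin_cases a <;> fin_cases b <;> fin_cases c <;> norm_num [Fin.ext_iff]

/-- **Registered stub `stub_values` (skeleton 358bc94d0325d3ad), def-free form.** On the shift set
the relay table takes only the values `0, ±1/2, ±1, ±1/64`. [this file] -/
theorem values (τ α : Fin 4 → Fin 4 → Fin 4 → ℤ × ℤ × ℤ → ℝ)
    (hτ : τ = fun (a b c : Fin 4) (μ : ℤ × ℤ × ℤ) =>
      if a = 0 ∧ b = 1 ∧ c = 1 then
        (if μ = (0, 0, 0) then (1 : ℝ) / 2 else if μ = (1, 0, 0) then -(1 / 2) else 0)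
      else if a = 1 ∧ b = 0 ∧ c = 2 then (if μ = (0, 1, 0) then (1 : ℝ) / 64 else 0)
      else if a = 2 ∧ b = 1 ∧ c = 1 then (if μ = (0, 0, 1) then (1 : ℝ) / 64 else 0)
      else 0)
    (hα : α = fun (a b c : Fin 4) (μ : ℤ × ℤ × ℤ) => τ a b c μ - τ c b a (μ.2.2, μ.2.1, μ.1) +
      τ b a c (μ.2.1, μ.1, μ.2.2) - τ c a b (μ.2.2, μ.1, μ.2.1)) :
    ∀ (a b c : Fin 4) (μ : ℤ × ℤ × ℤ), μ ∈ shiftSet →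
      (α a b c μ = 0 ∨ α a b c μ = 1 / 2 ∨ α a b c μ = -(1 / 2) ∨ α a b c μ = 1 ∨ α a b c μ = -1 ∨
        α a b c μ = 1 / 64 ∨ α a b c μ = -(1 / 64)) := by
  intro a b c μ hμ
  rw [mem_shiftSet_iff] at hμ
  rcases hμ with rfl | rfl | rfl | rfl
  · exact values_zero τ α hτ hα a b c
  · exact values_one τ α hτ hα a b c
  · exact values_two τ α hτ hα a b c
  · exact values_three τ α hτ hα a b c

/-- `64`-comparability of the relay table from its value set `{0, ±1/2, ±1, ±1/64}`: every entry
has modulus `≤ 1` and every non-zero one modulus `≥ 1/64`. [this file] -/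
theorem isComparableCoeff (α : Fin 4 → Fin 4 → Fin 4 → ℤ × ℤ × ℤ → ℝ)
    (h : ∀ (a b c : Fin 4) (μ : ℤ × ℤ × ℤ), μ ∈ shiftSet →
      (α a b c μ = 0 ∨ α a b c μ = 1 / 2 ∨ α a b c μ = -(1 / 2) ∨ α a b c μ = 1 ∨ α a b c μ = -1 ∨
        α a b c μ = 1 / 64 ∨ α a b c μ = -(1 / 64))) :
    IsComparableCoeff 64 α := by
  intro a b c μ hμ
  rcases h a b c μ hμ with h0 | h0 | h0 | h0 | h0 | h0 | h0 <;> rw [h0] <;> norm_num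

/-- **Registered stub `stub_rows` (skeleton 358bc94d0325d3ad), def-free form.** The closed forms
of the cascade nonlinearity `quadTerm 1 α` of the relay table, per component, are exactly the
completion-relay rows of the route statement: `ẋ_n`-term `-Λ_n u_n² + Λ_{n-1} u_{n-1}²`, `u̇_n`-term
`Λ_n (x_n u_n - u_n x_{n+1}) - (1/32) Λ_n x_{n+1} r_n + (1/32) Λ_{n-1} r_{n-1} u_{n-1}`, `ṙ_n`-term
`(1/32) Λ_n (x_{n+1} u_n - u_n u_{n+1})`, mode `3` idle (`Λ_k = 2^{5k/2}`). [this file] -/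
theorem rows (τ α : Fin 4 → Fin 4 → Fin 4 → ℤ × ℤ × ℤ → ℝ)
    (hτ : τ = fun (a b c : Fin 4) (μ : ℤ × ℤ × ℤ) =>
      if a = 0 ∧ b = 1 ∧ c = 1 then
        (if μ = (0, 0, 0) then (1 : ℝ) / 2 else if μ = (1, 0, 0) then -(1 / 2) else 0)
      else if a = 1 ∧ b = 0 ∧ c = 2 then (if μ = (0, 1, 0) then (1 : ℝ) / 64 else 0)
      else if a = 2 ∧ b = 1 ∧ c = 1 then (if μ = (0, 0, 1) then (1 : ℝ) / 64 else 0)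
      else 0)
    (hα : α = fun (a b c : Fin 4) (μ : ℤ × ℤ × ℤ) => τ a b c μ - τ c b a (μ.2.2, μ.2.1, μ.1) +
      τ b a c (μ.2.1, μ.1, μ.2.2) - τ c a b (μ.2.2, μ.1, μ.2.1)) :
    (∀ (X : Fin 4 → ℤ → ℝ → ℝ) (n : ℤ) (t : ℝ), quadTerm 1 α X 0 n t =
      -((1 + 1 : ℝ) ^ ((5 : ℝ) * n / 2) * (X 1 n t * X 1 n t)) +
        (1 + 1 : ℝ) ^ ((5 : ℝ) * ((n : ℝ) - 1) / 2) * (X 1 (n - 1) t * X 1 (n - 1) t)) ∧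
    (∀ (X : Fin 4 → ℤ → ℝ → ℝ) (n : ℤ) (t : ℝ), quadTerm 1 α X 1 n t =
      (1 + 1 : ℝ) ^ ((5 : ℝ) * n / 2) * (X 0 n t * X 1 n t - X 1 n t * X 0 (n + 1) t) -
        (1 / 32 : ℝ) * ((1 + 1 : ℝ) ^ ((5 : ℝ) * n / 2) * (X 0 (n + 1) t * X 2 n t)) +
        (1 / 32 : ℝ) * ((1 + 1 : ℝ) ^ ((5 : ℝ) * ((n : ℝ) - 1) / 2) *
          (X 2 (n - 1) t * X 1 (n - 1) t))) ∧
    (∀ (X : Fin 4 → ℤ → ℝ → ℝ) (n : ℤ) (t : ℝ), quadTerm 1 α X 2 n t =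
      (1 / 32 : ℝ) * ((1 + 1 : ℝ) ^ ((5 : ℝ) * n / 2) *
        (X 0 (n + 1) t * X 1 n t - X 1 n t * X 1 (n + 1) t))) ∧
    (∀ (X : Fin 4 → ℤ → ℝ → ℝ) (n : ℤ) (t : ℝ), quadTerm 1 α X 3 n t = 0) := by
  subst hα hτ
  refine ⟨fun X n t => ?_, fun X n t => ?_, fun X n t => ?_, fun X n t => ?_⟩ <;>
    simp only [quadTerm, sum_shiftSet, Fin.sum_univ_four] <;> simp <;> ring

end RelayTable

/-- **Crux `RelayTable` of route `CompletionRelayChain` (item stmt-NavierStokesRegularity-24851)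
holds**: the skew-form relay table `α = τ - (13)τ + (12)τ - (12)(13)τ` of the four-entry generator
`τ` (module docstring) lies in Tao's table class `E₂(64)` — symmetric (4.2) and cancelling (4.3) as
every skew-form table is, `64`-comparable by its value set `{0, ±1/2, ±1, ±1/64}` — and its cascade
nonlinearity `quadTerm 1 α` has exactly the completion-relay rows of the route statement. A design
fact about a MODEL lattice table; no statement about the Navier–Stokes equations. [this file] -/
theorem completionRelayChain_relayTable_proof :
    Summit.NavierStokesRegularity.NavierStokesRegularity.Theses.CompletionRelayChain.RelayTable := by
  classical
  -- the generator and its skew table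
  obtain ⟨τ, hτ⟩ : ∃ τ : Fin 4 → Fin 4 → Fin 4 → ℤ × ℤ × ℤ → ℝ, τ =
      fun (a b c : Fin 4) (μ : ℤ × ℤ × ℤ) =>
        if a = 0 ∧ b = 1 ∧ c = 1 then
          (if μ = (0, 0, 0) then (1 : ℝ) / 2 else if μ = (1, 0, 0) then -(1 / 2) else 0)
        else if a = 1 ∧ b = 0 ∧ c = 2 then (if μ = (0, 1, 0) then (1 : ℝ) / 64 else 0)
        else if a = 2 ∧ b = 1 ∧ c = 1 then (if μ = (0, 0, 1) then (1 : ℝ) / 64 else 0)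
        else 0 := ⟨_, rfl⟩
  obtain ⟨α, hα⟩ : ∃ α : Fin 4 → Fin 4 → Fin 4 → ℤ × ℤ × ℤ → ℝ, α =
      fun (a b c : Fin 4) (μ : ℤ × ℤ × ℤ) => τ a b c μ - τ c b a (μ.2.2, μ.2.1, μ.1) +
        τ b a c (μ.2.1, μ.1, μ.2.2) - τ c a b (μ.2.2, μ.1, μ.2.1) := ⟨_, rfl⟩
  exact ⟨α, ⟨TriggerChainTable.heteroclinicTriggerChain_isSymmetricCoeff_of_skew τ α hα,
    TriggerChainTable.heteroclinicTriggerChain_isCancellingCoeff_of_skew τ α hα,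
    RelayTable.isComparableCoeff α (RelayTable.values τ α hτ hα)⟩, RelayTable.rows τ α hτ hα⟩

end Summit.NavierStokesRegularity.NavierStokesRegularity.Theorems
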